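/-
Copyright (c) 2026. All rights reserved.
Released under Apache 2.0 license as described in the file LICENSE.
Authors: abc-iut cell — seat abc-iut-w4-d104 (gen 2): proof-only note on the germ MODEL of [AbsTopIII]
Prop 2.6 (this seat's gen 0, p412533) — what "functoriality along holomorphic maps" can and cannot mean
for the germ groups `𝒜_p` (input for GAP-LEDGER row G-w5d226-1, Cor 2.7 (e) functoriality).
-/
import Literature.AnabelianGeometry.AbsoluteAnabelian.HolomorphicCoresLocalLinearProofs
import Mathlib.Analysis.Calculus.Deriv.Comp
import Mathlib.Analysis.Calculus.Deriv.Mul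
import Mathlib.Analysis.Calculus.Deriv.Add
import Mathlib.Analysis.Calculus.Deriv.Inv
import HarnessLib

/-!
# [AbsTopIII] Prop 2.6 (a)/(b), Cor 2.7 (e): conjugating germs of `𝒜_p` by holomorphic maps

S. Mochizuki, *Topics in absolute anabelian geometry III* (bib key `MochizukiAbsTopIII2015`), Prop 2.6 (a)
(kurims p.57): "we have a natural isomorphism of topological groups `ℂ^× ⥲ 𝒜_p` [induced by the
tautological action of `ℂ^×` on `ℂ ⊇ U`]"; Cor 2.7 (e) (p.60): "compatible isomorphisms `𝒜_p ⥲ 𝒜_{p'}`";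
Def 4.1 (i) (p.101): "`𝒜_𝕏` … may be identified … via the various isomorphisms `𝒜_p ⥲ 𝒜_{p'}` of
Corollary 2.7, (e), together with the functoriality of the algorithms of Corollary 2.7".

In the germ MODEL (`HolomorphicCoresLocalLinearProofs.lean`, abc-iut-w4-d104 gen 0) `𝒜_p = germAut p` is
the group of germs `z ↦ p + c (z − p)`, `c ∈ ℂ^×` (`mem_germAut_iff`), labelled by the MULTIPLIER `c`
(`germAutIsoUnits p : ℂ^× ≃ₜ* 𝒜_p`).  GAP-LEDGER row G-w5d226-1 (functoriality datum of Cor 2.7 (e) along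
structure-isomorphisms) proposes to "instantiate at [this] germ MODEL … where the induced map along a
biholomorphism is concrete conjugation of germs".  This PROOF-ONLY file records what the kernel says
about that proposal:

* `hasDerivAt_conj_mulAffine` — POSITIVE: conjugating the affine representative `z ↦ p + c (z − p)` by a
  map `φ` complex-differentiable at `p` with `φ'(p) ≠ 0` (local inverse `ψ` at `q = φ p`) yields a map with
  complex derivative `c` at `q`: the MULTIPLIER is a conjugation invariant (commutativity of `ℂ`), so the
  identification `ℂ^× ⥲ 𝒜_p` by multipliers is compatible with every holomorphic change of coordinates —
  THIS is the functoriality datum the germ model offers: along a local biholomorphism `φ`, `𝒜_p ⥲ 𝒜_{φ p}`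
  is `germAutIsoUnits (φ p) ∘ (germAutIsoUnits p)⁻¹` ("same multiplier"), cf. `germAutTrans` for
  translations (Prop 2.6 (b));
* `conj_mulAffine_moebius` / `germ_conj_not_mem_range_mulGerm` — NEGATIVE: literal conjugation of GERMS
  does NOT preserve `𝒜_p`: for the Möbius map `φ z = z / (1 − z)` (holomorphic near `0`, `φ 0 = 0`,
  `φ' 0 = 1`, local inverse `ψ w = w / (1 + w)`) the conjugate of `z ↦ 2 z` is `w ↦ 2 w / (1 − w)`, whose
  germ at `0` is NOT the germ of any `w ↦ c w` — so "induced map = conjugation of germs" would not even land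
  in `𝒜_{φ p}`; only its linearisation (the multiplier) is intrinsic.

Refereed pre-IUT material ([AbsTopIII] §2); nothing here bears on the disputed [IUTchIII] Cor. 3.12;
typed ≠ endorsed.  No new definitions.
-/

namespace Literature.AnabelianGeometry.AbsoluteAnabelian

open _root_.Complex _root_.Set _root_.Topology _root_.Filter _root_.Metric

noncomputable section

/-! ### Positive: the multiplier is a conjugation invariant -/

/-- The affine representative `z ↦ p + c (z − p)` of a germ of `𝒜_p` has complex derivative `c` everywhere.
(Auxiliary.) [cite: MochizukiAbsTopIII2015, Proposition 2.6 (a) p.57] -/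
theorem hasDerivAt_mulAffine (p c z : ℂ) : HasDerivAt (fun z => p + c * (z - p)) c z := by
  have h := ((hasDerivAt_id z).sub_const p).const_mul c
  simpa using h.const_add p

/-- **Prop 2.6 (a)/Cor 2.7 (e), conjugation invariance of the multiplier**: if `φ` is complex-differentiable
at `p` with derivative `d ≠ 0` and `ψ` is a local inverse branch at `q` with `ψ q = p` and derivative `d⁻¹`
(e.g. `φ` a local biholomorphism, `ψ = φ⁻¹`), then the conjugate `φ ∘ (z ↦ p + c (z − p)) ∘ ψ` of the
affine representative of multiplier `c` has complex derivative `c` at `q` — for EVERY such `φ`, by the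
commutativity of `ℂ`.  Hence the labelling of `𝒜_p` by multipliers (`germAutIsoUnits`) is independent of
holomorphic coordinates. [cite: MochizukiAbsTopIII2015, Proposition 2.6 (a) p.57] -/
theorem hasDerivAt_conj_mulAffine {φ ψ : ℂ → ℂ} {p q d : ℂ} (c : ℂ) (hφ : HasDerivAt φ d p)
    (hψ : HasDerivAt ψ d⁻¹ q) (hψq : ψ q = p) (hd : d ≠ 0) :
    HasDerivAt (φ ∘ (fun z => p + c * (z - p)) ∘ ψ) c q := by
  have hm : HasDerivAt (fun z => p + c * (z - p)) c (ψ q) := hasDerivAt_mulAffine p c (ψ q)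
  have h1 : HasDerivAt ((fun z => p + c * (z - p)) ∘ ψ) (c * d⁻¹) q := hm.comp q hψ
  have hval : ((fun z => p + c * (z - p)) ∘ ψ) q = p := by simp [hψq]
  have hφ' : HasDerivAt φ d (((fun z => p + c * (z - p)) ∘ ψ) q) := by rw [hval]; exact hφ
  have h2 := hφ'.comp q h1
  have hcd : d * (c * d⁻¹) = c := by field_simp
  rw [hcd] at h2
  exact h2

/-- In particular, at a local biholomorphism the conjugates of the affine representatives of two germs of
`𝒜_p` have the same derivative at `q = φ p` iff the germs have the same multiplier: the multiplier, not the
germ, is what transports. [cite: MochizukiAbsTopIII2015, Corollary 2.7 (e) p.60] -/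
theorem deriv_conj_mulAffine_eq_iff {φ ψ : ℂ → ℂ} {p q d : ℂ} (c c' : ℂ) (hφ : HasDerivAt φ d p)
    (hψ : HasDerivAt ψ d⁻¹ q) (hψq : ψ q = p) (hd : d ≠ 0) :
    deriv (φ ∘ (fun z => p + c * (z - p)) ∘ ψ) q = deriv (φ ∘ (fun z => p + c' * (z - p)) ∘ ψ) q ↔
      c = c' := by
  rw [(hasDerivAt_conj_mulAffine c hφ hψ hψq hd).deriv, (hasDerivAt_conj_mulAffine c' hφ hψ hψq hd).deriv]

/-! ### Negative: conjugation of germs does not preserve `𝒜_p` -/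

/-- The Möbius conjugation computed: for `φ z = z / (1 − z)` and its inverse branch `ψ w = w / (1 + w)`,
`φ (2 ψ w) = 2 w / (1 − w)` whenever `w ≠ -1`, `w ≠ 1`. (Auxiliary.)
[cite: MochizukiAbsTopIII2015, Corollary 2.7 (e) p.60] -/
theorem conj_mulAffine_moebius {w : ℂ} (hw : w ≠ -1) (hw' : w ≠ 1) :
    (fun z : ℂ => z / (1 - z)) ((0 : ℂ) + 2 * (w / (1 + w) - 0)) = 2 * w / (1 - w) := by
  have h1 : (1 : ℂ) + w ≠ 0 := by
    intro h; apply hw; linear_combination h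
  have h2 : (1 : ℂ) - w ≠ 0 := sub_ne_zero.2 (Ne.symm hw')
  have h3 : (1 : ℂ) - 2 * (w / (1 + w)) = (1 - w) / (1 + w) := by field_simp; ring
  simp only [zero_add, sub_zero]
  rw [h3, div_div_eq_mul_div]
  field_simp

/-- The Möbius map `φ z = z / (1 − z)` fixes `0`, is complex-differentiable there with derivative `1`, and
`ψ w = w / (1 + w)` is its local inverse (`ψ 0 = 0`, derivative `1 = 1⁻¹`): a legitimate holomorphic change
of coordinates at `0`. (Auxiliary.) [cite: MochizukiAbsTopIII2015, Corollary 2.7 (e) p.60] -/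
theorem moebius_coordinate_change :
    HasDerivAt (fun z : ℂ => z / (1 - z)) 1 0 ∧ HasDerivAt (fun w : ℂ => w / (1 + w)) 1⁻¹ 0 ∧
      (fun w : ℂ => w / (1 + w)) 0 = 0 ∧
      ∀ᶠ w in 𝓝 (0 : ℂ), (fun z : ℂ => z / (1 - z)) ((fun w : ℂ => w / (1 + w)) w) = w := by
  refine ⟨?_, ?_, by simp, ?_⟩
  · refine ((hasDerivAt_id' (0 : ℂ)).div
      ((hasDerivAt_const (0 : ℂ) (1 : ℂ)).sub (hasDerivAt_id' (0 : ℂ))) (by simp)).congr_deriv ?_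
    norm_num
  · refine ((hasDerivAt_id' (0 : ℂ)).div
      ((hasDerivAt_const (0 : ℂ) (1 : ℂ)).add (hasDerivAt_id' (0 : ℂ))) (by simp)).congr_deriv ?_
    norm_num
  · have hopen : IsOpen {w : ℂ | w ≠ -1} := isOpen_ne
    filter_upwards [hopen.mem_nhds (by simp : (0 : ℂ) ≠ -1)] with w hw
    have h1 : (1 : ℂ) + w ≠ 0 := by
      intro h; apply hw; linear_combination h
    field_simp
    ring

/-- The conjugated map `w ↦ 2 w / (1 − w)` tends to `0` at `0`, so it defines a local germ at `0`.
(Auxiliary.) [cite: MochizukiAbsTopIII2015, Corollary 2.7 (e) p.60] -/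
theorem tendsto_conj_moebius : Tendsto (fun w : ℂ => 2 * w / (1 - w)) (𝓝 0) (𝓝 0) := by
  have hc : ContinuousAt (fun w : ℂ => 2 * w / (1 - w)) 0 :=
    ((continuous_const.mul continuous_id).continuousAt).div
      ((continuous_const.sub continuous_id).continuousAt) (by simp)
  simpa using hc.tendsto

/-- **Conjugation of germs does NOT preserve `𝒜_p` (G-w5d226-1, negative half)**: the germ at `0` of the
conjugate `w ↦ 2 w / (1 − w)` of the `𝒜_0`-germ `z ↦ 2 z` by the holomorphic coordinate change
`φ z = z / (1 − z)` (`moebius_coordinate_change`, `conj_mulAffine_moebius`) is not the germ of ANY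
multiplication `w ↦ c w`; by `mem_germAut_iff` (`𝒜_0` = the multiplication germs) it is therefore not (the
underlying germ of) an element of `𝒜_0 = germAut 0`.  So the functoriality of Cor 2.7 (e) at the germ
model is the transport of MULTIPLIERS (`hasDerivAt_conj_mulAffine`), not literal conjugation.
[cite: MochizukiAbsTopIII2015, Corollary 2.7 (e) p.60] -/
theorem germ_conj_not_mem_range_mulGerm (c : ℂ) :
    LocGerm.ofFun (fun w : ℂ => 2 * w / (1 - w)) tendsto_conj_moebius ≠ LocGerm.mulGerm 0 c := by
  intro h
  rw [LocGerm.mulGerm, LocGerm.ofFun_eq_ofFun_iff] at h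
  -- two distinct small non-zero points where `2 w / (1 - w) = c w`
  obtain ⟨ε, hε, hball⟩ := Metric.eventually_nhds_iff.1 h
  have key : ∀ t : ℝ, 0 < t → t < ε → t < 1 → (2 : ℂ) / (1 - t) = c := by
    intro t ht htε ht1
    have hmem : dist ((t : ℝ) : ℂ) 0 < ε := by
      rw [dist_zero_right, Complex.norm_real, Real.norm_of_nonneg ht.le]; exact htε
    have h := hball hmem
    simp only [zero_add, sub_zero] at h
    have ht0 : ((t : ℝ) : ℂ) ≠ 0 := by exact_mod_cast ht.ne'
    have h1t : (1 : ℂ) - t ≠ 0 := by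
      have : (t : ℂ) ≠ 1 := by exact_mod_cast ht1.ne
      exact sub_ne_zero.2 (Ne.symm this)
    field_simp at h
    field_simp
    linear_combination h
  set t₁ : ℝ := min (ε / 2) (1 / 2) with ht₁
  set t₂ : ℝ := min (ε / 3) (1 / 3) with ht₂
  have h₁ := key t₁ (by positivity) (lt_of_le_of_lt (min_le_left _ _) (by linarith))
    (lt_of_le_of_lt (min_le_right _ _) (by norm_num))
  have h₂ := key t₂ (by positivity) (lt_of_le_of_lt (min_le_left _ _) (by linarith))
    (lt_of_le_of_lt (min_le_right _ _) (by norm_num))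
  have hne : t₁ ≠ t₂ := by
    intro h12
    -- `t₁ = min (ε/2) (1/2)` exceeds `t₂ = min (ε/3) (1/3)`
    have : t₂ < t₁ := by
      rw [ht₁, ht₂]
      rcases le_total (ε / 2) (1 / 2) with h | h
      · rw [min_eq_left h]
        exact lt_of_le_of_lt (min_le_left _ _) (by linarith)
      · rw [min_eq_right h]
        exact lt_of_le_of_lt (min_le_right _ _) (by norm_num)
    linarith
  have h1t₁ : (1 : ℂ) - t₁ ≠ 0 := by
    have : (t₁ : ℂ) ≠ 1 := by
      exact_mod_cast (lt_of_le_of_lt (min_le_right _ _) (by norm_num) : t₁ < 1).ne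
    exact sub_ne_zero.2 (Ne.symm this)
  have h1t₂ : (1 : ℂ) - t₂ ≠ 0 := by
    have : (t₂ : ℂ) ≠ 1 := by
      exact_mod_cast (lt_of_le_of_lt (min_le_right _ _) (by norm_num) : t₂ < 1).ne
    exact sub_ne_zero.2 (Ne.symm this)
  have heq : (2 : ℂ) / (1 - t₁) = 2 / (1 - t₂) := h₁.trans h₂.symm
  rw [div_eq_div_iff h1t₁ h1t₂] at heq
  have : (t₁ : ℂ) = t₂ := by linear_combination heq / 2
  exact hne (by exact_mod_cast this)

/-- The same, phrased on `𝒜_0`: no element of `germAut 0` has the conjugated germ as its underlying germ.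
[cite: MochizukiAbsTopIII2015, Corollary 2.7 (e) p.60] -/
theorem germ_conj_not_mem_germAut :
    ¬ ∃ u ∈ germAut (0 : ℂ), (u : LocGerm 0) = LocGerm.ofFun (fun w : ℂ => 2 * w / (1 - w)) tendsto_conj_moebius := by
  rintro ⟨u, hu, hval⟩
  obtain ⟨c, rfl⟩ := (mem_germAut_iff u).1 hu
  exact germ_conj_not_mem_range_mulGerm (c : ℂ) (by rw [← hval]; rfl)

end

end Literature.AnabelianGeometry.AbsoluteAnabelian
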